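import Summits.BirchSwinnertonDyer.BirchSwinnertonDyer.Theorems.SchneiderFreeAdditiveX3AnticycControlAdditiveK
import Summits.BirchSwinnertonDyer.BirchSwinnertonDyer.Theorems.SchneiderFreeAdditiveX3AnticycControlAdditiveCruxOfBaseCountTors
import Summits.BirchSwinnertonDyer.Rank1Residual.Additive.GordRankZeroChiBranch
import HarnessLib

/-!
# The control corner of the K1 door, CLASS-FREE: anticyclotomic control at an additive prime for EVERY
# semistable-twist curve — no `ClassX3`, no reducibility, no outer `r_an = 1`

Cell `bsd-schneider-ideate`, seat `bsd-schneider-door-c4` (prover, generation 22).  PARTITION: board row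
B6 ∩ sst-twist, `r = 1`, of `Rank1Residual.partition` — CONTROL corner, now stated on X3 ∪ X4 (reducible AND
irreducible `E[p]`).  bears_on: K1-door (route-BirchSwinnertonDyer-SchneiderFreeAdditiveX3, items 18969 →
19178 record → 19295 CLOSED) and the (γ) X4 sibling door of the base unit's memo ROUTE-P2-v6-g9 L85–L87
(«CLASS-FREE CONTROL … the honest statement of what door-c4/c5/c6 prove»).

WHAT IS PROVED.  The crux `AnticycControlAdditiveK` (stmt-BirchSwinnertonDyer-19295, closed by door-c4 g19)
asserts the pointwise anticyclotomic control input `SchneiderFree.AdditiveControlInputManinAt E p` under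
Kolyvagin's theorem for `E` in B6's REDUCIBLE semistable-twist class (`ClassX3 E p ∧ SubSemistableTwist E p`,
`r_an(E) = 1`).  Reading the landed chain shows that reducibility of `E[p]` (the `Red` half of `ClassX3`)
enters at ONE place only: in Fin_v (`LocalTowerTorsionFiniteX3`), `classX3Gord_of_subGordTwo_of_odd` infers
(G)-ORDINARITY of the potentially good `p*`-twist from the rational `p`-isogeny.  But the socket
`AdditiveControlInputManinAt E p` itself quantifies over `N10.Locus E p = (p ≠ 2 ∧ Addv ∧ (PotMult ∨ TypeGOrd))`,
so ordinarity is a HYPOTHESIS of every frame, and the class-free twist models are in the tree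
(`Additive.TypeGOrd.exists_goodOrd_pStar_twist_model`, `AdditivePotMult.PotMult.exists_mult_pStar_twist_model`).
Everything else — the torsion-robust count `additiveControlOnTreeAt_of_torsAtoms`, the Poitou–Tate atoms
`ptSurj_of_finite` / `coinvariantsTrivialAt_of_finite_anyTorsion` / `additiveBaseSelmerCountTors_of_rankOne_anyTorsion` /
`finite_selmerAcBase_of_rankOne_anyTorsion`, Brink's two decomposition facts, the kernel counts, the line
characters and `localTowerTorsionFiniteAt_of_lineCharacter` — is stated per frame with no class hypothesis.
Hence, re-assembling the SAME cores (nothing re-proved):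

* `localTowerTorsionFiniteAt_classFree` — Fin_v (`E(K̄)[p^∞]^{D_𝔭 ⊓ Gal(K̄/K_∞^ac)}` finite) for EVERY
  globally minimal `E/ℚ`, odd additive `p`, `E` potentially multiplicative or (G)-ordinary of defect `2`,
  every imaginary quadratic `K` with `p` split, anticyclotomic `κ`, `𝔭 ∣ p`;
* `additiveControlInputManinAt_classFree_of_facts` / **`additiveControlInputManinAt_classFree`** — under
  Kolyvagin's theorem, `SchneiderFree.AdditiveControlInputManinAt E p` for EVERY globally minimal `E/ℚ` and
  prime `p` with `Additive.PotMult E p ∨ Additive.semistabilityIndex E p = 2` (the socket itself carries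
  `N10.Locus E p`, i.e. `p` odd additive potentially ordinary, and `r_an = 1`; so this covers exactly the
  semistable-twist cells (M) ∪ (G-ord, `e = 2`) of X3 AND X4);
* `additiveControlInputManinAt_of_subSemistableTwist` — hypothesis `Additive.SubSemistableTwist E p` (the X3
  items' shape minus `ClassX3`); `additiveControlInputManinAt_of_cellM_or_cellGordTwo` — hypothesis
  `N10.CellM E p ∨ N10.CellGordTwo E p` (the shape of the X4 leaf `AdditiveX4RankOneLower` of memo L85);
* `anticycControlAdditiveK_of_classFree` — the X3 crux decl by restriction (consistency check; it is
  already closed by `anticycControlAdditiveK_proof`).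

HONEST FRAMING.  CONDITIONAL exactly like the crux: Kolyvagin's theorem (`kolyvagin`, cite-only) is the
displayed antecedent; every other input is a tree theorem (Poitou–Tate (i)/(ii) `_holds`, Brink Thm 2 /
Cor 1 `_holds`, the anticyclotomic norm-residue-symbol fact `_holds`, Tate uniformisation `_holds`).  No new
definition, no new named fact, no `sorry`.  Closes NO item (the X4 door is a memo line awaiting a director
GO); «closes rung: none»; BSD is NOT proved by any of this.

References: [JetchevSkinnerWan2017] Thm. 3.3.1, Prop. 3.2.1, Prop. 3.3.2, Prop. 3.3.4 Case 3(b)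
(arXiv:1512.06894 pp. 10–13); [GreenbergLNM1716] §2 p. 70, §4 Lemma 4.3; [Brink2007] Thm. 2, Cor. 1;
[MilneADT2006] I Thm. 4.10; [SilvermanATAEC1994] V Thm. 5.3, Cor. 5.4; [Gross1991] Thm. 1.3.
-/

noncomputable section

open scoped Classical

open Field NumberField IsDedekindDomain WeierstrassCurve
open Literature.NumberTheory.EllipticCurves Literature.NumberTheory.EllipticCurves.GreenbergSelmer
open Literature.NumberTheory.GaloisRepresentations
open Literature.NumberTheory.GaloisCohomology
open Literature.NumberTheory.Automorphic
open Literature.NumberTheory.EllipticCurves.ModularForms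
  Literature.NumberTheory.EllipticCurves.Rank1Residual
  Literature.NumberTheory.EllipticCurves.Rank1Residual.Typed
  Summit.BirchSwinnertonDyer.Rank1Residual
  Summit.BirchSwinnertonDyer.Rank1Residual.X11b
  Summit.BirchSwinnertonDyer.Rank1Residual.X11b.AcSelmer
  Summit.BirchSwinnertonDyer.Rank1Residual.X11b.LocBridge

-- `Summit.<P>.<Sub>` repeats `BirchSwinnertonDyer` by the tree's layout convention (D-0017)
set_option linter.dupNamespace false

namespace Summit.BirchSwinnertonDyer.BirchSwinnertonDyer.Theorems.SchneiderFreeAdditiveX3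

open Summit.BirchSwinnertonDyer.BirchSwinnertonDyer.Theses.SchneiderFreeAdditiveX3
  Summit.BirchSwinnertonDyer.BirchSwinnertonDyer.Theorems.SchneiderFree
  Summit.BirchSwinnertonDyer.BirchSwinnertonDyer.Theorems.SchneiderFreeControlAtoms
  Summit.BirchSwinnertonDyer.BirchSwinnertonDyer.Theorems.SchneiderFreeAdditiveX3.PoitouTateReduction

/-! ## §1. Fin_v, class-free -/

/-- **Fin_v on EVERY semistable-twist curve (class-free).**  For a globally minimal `E/ℚ`, an odd prime `p`
of ADDITIVE reduction at which `E` is potentially multiplicative, or (G)-ordinary of semistability defect `2`,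
every imaginary quadratic `K` with `p` split, every anticyclotomic `ℤ_p`-extension `κ` of `K` and every
`𝔭 ∣ p`: the `p`-primary torsion of `E` over the completed anticyclotomic tower, `E(K̄)[p^∞]^{D_𝔭 ⊓ ker κ}`,
is finite.  Proof = the landed one with class-free twist models: (M) the Tate line of the multiplicative
`p*`-twist model (`PotMult.exists_mult_pStar_twist_model`, `exists_lineCharacter_of_mult_twist_baseChange`,
character `± χ_p`, `a = p + 1`, `α = 1`); (G-ord, `e = 2`) Greenberg's reduction line of the good ordinary
`p*`-twist (`TypeGOrd.exists_goodOrd_pStar_twist_model`, `unitRootCharacter`,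
`lineCharacter_rat_of_goodOrd_pStar_twist_of_unitRoot`, transported to `(K, 𝔭)` by
`lineCharacter_baseChange_of_splitsIn`); then `localTowerTorsionFiniteAt_of_lineCharacter` with the PROVED
norm-residue-symbol fact `ZpExtension.exists_isFrobPow_mem_kerSubgroup_of_isAnticyclotomic_holds`.
No `ClassX3`, no `r_an`. [cite: JetchevSkinnerWan2017, §3.3 Prop. 3.3.4 Case 3(b), Remark 3.3.5 (arXiv:1512.06894 p. 13)]
[cite: GreenbergLNM1716, §2 p. 70 (after Prop. 2.4)] [cite: SilvermanATAEC1994, Ch. V Thm. 5.3, Cor. 5.4] -/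
theorem localTowerTorsionFiniteAt_classFree (W : WeierstrassCurve ℚ) [W.IsElliptic] [W.IsGloballyMinimal]
    (p : ℕ) [Fact p.Prime] (hp2 : p ≠ 2) (hadd : Addv W p)
    (hcell : Additive.PotMult W p ∨ (Additive.TypeGOrd W p ∧ Additive.semistabilityIndex W p = 2))
    (K : Type) [Field K] [NumberField K] (hK : IsImaginaryQuadratic K) (hsplit : SplitsIn K p)
    (κ : ZpExtension K p) (hκ : κ.IsAnticyclotomic)
    (𝔭 : HeightOneSpectrum (𝓞 K)) (h𝔭 : ((p : ℕ) : 𝓞 K) ∈ 𝔭.asIdeal) :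
    LocalTowerTorsionFiniteAt (W.baseChange K) p κ 𝔭 := by
  have hCFT := ZpExtension.exists_isFrobPow_mem_kerSubgroup_of_isAnticyclotomic_holds K p
  rcases hcell with hM | ⟨hG, he⟩
  · -- (M): the Tate line of the multiplicative `p*`-twist model, character `± χ_p`
    have hPM : AdditivePotMult.PotMult W p := ⟨hadd, hM⟩
    obtain ⟨V, _, _, C₀, hV, hC₀⟩ := hPM.exists_mult_pStar_twist_model hp2
    haveI := liesOver_span_of_natCast_mem (K := K) h𝔭
    have hdeg := ramificationIdx_mul_inertiaDeg_eq_one_of_splitsIn hK.1 hsplit h𝔭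
    have h𝔭2 := Summit.Ventures.HodgeRepro2.T5DegreeOneNumberField.natCast_notMem_sq 𝔭 p hdeg
    obtain ⟨C, hCD, hcard, hord, hτ, hchar⟩ :=
      exists_lineCharacter_of_mult_twist_baseChange
        TateCurve.Silverman1994_thmV53_corV54_tateUniformisation_holds V hV hC₀ K 𝔭 h𝔭 h𝔭2
    refine localTowerTorsionFiniteAt_of_lineCharacter W hp2 hK hsplit κ hκ 𝔭 h𝔭 hCFT C hCD hcard hord hτ
      ((p : ℤ) + 1) 1 (by push_cast; ring) fun σ n _ ↦ ?_
    obtain ⟨s, hs, hc⟩ := hchar σ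
    refine ⟨s, hs, fun k c hcC hpc N hN ↦ hc k c hcC hpc N ?_⟩
    simpa only [inv_one, one_pow, mul_one] using hN
  · -- (G-ord, `e = 2`): Greenberg's reduction line of the good ordinary `p*`-twist with its unit-root character
    obtain ⟨V, _, _, C₀, hV, hC₀⟩ := Additive.TypeGOrd.exists_goodOrd_pStar_twist_model W p hp2 hG hadd he
    have hpv : ((p : ℕ) : 𝓞 ℚ) ∈ (ratPlace p).asIdeal :=
      (natCast_mem_asIdeal_iff_eq_primesEquiv_symm (ratPlace p) Fact.out).mpr rfl
    obtain ⟨C, a, α, hCD, hC1, hCord, hτ, hα, hchar⟩ :=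
      lineCharacter_rat_of_goodOrd_pStar_twist_of_unitRoot hp2 V hV hpv
        (fun hΔ ↦ unitRootCharacter p (ratPlace p) hpv V hV hΔ) ⟨C₀, hC₀⟩
    obtain ⟨C', a', α', hCD', hC1', hCord', hτ', hα', hchar'⟩ :=
      lineCharacter_baseChange_of_splitsIn K W hK hsplit hpv 𝔭 h𝔭 C hCD hC1 hCord hτ a α hα hchar
    exact localTowerTorsionFiniteAt_of_lineCharacter W hp2 hK hsplit κ hκ 𝔭 h𝔭 hCFT C' hCD' hC1' hCord'
      hτ' a' α' hα' hchar'

/-! ## §2. The control input, class-free -/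

/-- **Anticyclotomic control at an additive prime for EVERY semistable-twist curve, from the four cited
Poitou–Tate / Brink facts as explicit antecedents and Kolyvagin's theorem** (the `ControlFacts`-binder
shape of the X3 item `AnticycControlAdditiveKF`, WITHOUT `ClassX3` and without the outer `r_an = 1`): for
every globally minimal `E/ℚ` and prime `p` with `E` potentially multiplicative at `p` or of semistability
defect `2` at `p` (`Additive.PotMult E p ∨ Additive.semistabilityIndex E p = 2`), the pointwise control
input `SchneiderFree.AdditiveControlInputManinAt E p` — at every B6 Heegner datum and every anticyclotomic
frame `(κ, γ, 𝔭)`, `ord_p f_ac(0) = ord_p #Ш(E/K)[p^∞] + 2(ord_p log_ω P − ord_p[E(K):ℤP]) + ord_p ∏ c_w`.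
The assembly is door-c6/door-c4's (`stub_baseCountTors_of_facts` ∘ `anticycControlAdditiveK_of_facts_of_baseCountTors`)
with the per-frame cores called directly and Fin_v from `localTowerTorsionFiniteAt_classFree`.
CONDITIONAL (hypotheses BY NAME); BSD is not proved by this.
[cite: JetchevSkinnerWan2017, Thm. 3.3.1, Prop. 3.2.1, Prop. 3.3.2 (arXiv:1512.06894 pp. 10–12)]
[cite: MilneADT2006, Ch. I, Thm. 4.10 (a),(b)] [cite: Brink2007, Thm. 2 and Cor. 1] [cite: Gross1991, Thm. 1.3] -/
theorem additiveControlInputManinAt_classFree_of_facts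
    (hPT : ∀ (K : Type) [Field K] [NumberField K], poitouTate_selmerStructure_duality K)
    (hPT2 : ∀ (K : Type) [Field K] [NumberField K], poitouTate_sha_tateDual K)
    (hBr : ∀ (K : Type) [Field K] [NumberField K] (p : ℕ) [Fact p.Prime],
      ZpExtension.decomp_not_le_kerSubgroup_of_isAnticyclotomic K p)
    (hBrA : ∀ (K : Type) [Field K] [NumberField K] (p : ℕ) [Fact p.Prime],
      ZpExtension.decomp_not_le_kerSubgroup_above_of_isAnticyclotomic K p)
    (hKo : ∀ (N : ℕ) [NeZero N] (W : WeierstrassCurve ℚ) (K : Type) [Field K] [NumberField K],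
      Literature.NumberTheory.EllipticCurves.kolyvagin N W K)
    (W : WeierstrassCurve ℚ) [W.IsElliptic] [W.IsGloballyMinimal] (p : ℕ) [Fact p.Prime]
    (hcell : Additive.PotMult W p ∨ Additive.semistabilityIndex W p = 2) :
    SchneiderFree.AdditiveControlInputManinAt W p := by
  intro N _ K _ _ Dt H ι P hr hloc hN hK hodd hunit hHe hL1 hP hnt κ hκ γ hγ 𝔭 h𝔭 he hf
  have hp : p.Prime := Fact.out
  have hp2 : p ≠ 2 := hloc.1
  have hadd : Addv W p := hloc.2.1
  -- the cell datum for Fin_v: (M), or (G-ord) with defect 2 — ordinarity comes from the LOCUS (a hypothesis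
  -- of the frame), NOT from reducibility of `E[p]`
  have hcell' : Additive.PotMult W p ∨ (Additive.TypeGOrd W p ∧ Additive.semistabilityIndex W p = 2) := by
    rcases hcell with hM | he2
    · exact Or.inl hM
    · rcases hloc.2.2 with hM | hG
      · exact Or.inl hM
      · exact Or.inr ⟨hG, he2⟩
  haveI : IsTotallyComplex K := hK.2
  haveI hEK : (W.baseChange K).IsElliptic := by rw [baseChange]; infer_instance
  have hpN : p ∣ W.conductorNorm ℤ := dvd_conductorNorm_of_n10Locus hloc
  have hsplit : SplitsIn K p := splitsIn_of_satisfiesHeegnerHypothesis hN hHe hpN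
  obtain ⟨hrank, hSha⟩ := hKo N W K hK hHe ⟨Dt, H, ι, hP⟩ hnt
  -- (KER-res): `#ker res = #E(K)[p^∞] = p^g`, `g = ord_p #E(K)[p^∞]`
  set g := padicValNat p (Nat.card (AddCommGroup.primaryComponent (W.baseChange K).toAffine.Point p))
    with hgdef
  have hcardg := natCard_primaryComponent_point_eq_pow (W.baseChange K) p
  haveI := finite_fixedPoints_kerSubgroup_of_not_dvd_torsionOrder W p κ hp2 hK hunit hκ
  have hg : Nat.card ((W.baseChange K).resOfLe p (le_top : κ.kerSubgroup ≤ ⊤)).ker = p ^ g := by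
    rw [natCard_ker_resOfLe_top_eq_natCard_fixedPoints (W.baseChange K) p κ,
      natCard_fixedPoints_geomPrimaryTorsion_eq_natCard_primaryComponent (W.baseChange K) p, hcardg]
  -- (KER-𝔭): `#ker r_𝔭 = #E(ℚ_p)[p^∞] = p^t` (Fin_v, class-free, + Brink Cor. 1 above `p`)
  obtain ⟨t, htp⟩ := exists_natCard_primaryComponent_padic_eq_pow W p
  have hFin : LocalTowerTorsionFiniteAt (W.baseChange K) p κ 𝔭 :=
    localTowerTorsionFiniteAt_classFree W p hp2 hadd hcell' K hK hsplit κ hκ 𝔭 h𝔭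
  have ht := natCard_localKer_eq_pow_of_finite W p κ 𝔭 h𝔭 he hf hFin (hBrA K p hK hp2 κ hκ 𝔭 h𝔭) htp
  -- (P6-add-tors): the torsion-aware base count `#Sel_𝔭 · p^t = p^a`
  obtain ⟨hfin𝔭, a, hcard, ha⟩ := additiveBaseSelmerCountTors_of_rankOne_anyTorsion W p K (hPT K)
    (fun v ↦ localEulerPoincareCharacteristic_adicCompletionEP K v) hadd hK hsplit hrank hSha P hnt
    𝔭 h𝔭 he hf
  have hcard' : Nat.card (selmerAcBase (W.baseChange K) p 𝔭 ∅) * p ^ t = p ^ a := by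
    rw [← htp]; exact hcard
  have hle : t ≤ a :=
    (Nat.pow_dvd_pow_iff_le_right hp.one_lt).mp ⟨_, by rw [mul_comm]; exact hcard'.symm⟩
  have hcardSel : Nat.card (selmerAcBase (W.baseChange K) p 𝔭 ∅) = p ^ (a - t) := by
    have hsplitpow : p ^ a = p ^ (a - t) * p ^ t := by rw [← pow_add, Nat.sub_add_cancel hle]
    rw [hsplitpow] at hcard'
    exact Nat.eq_of_mul_eq_mul_right (pow_pos hp.pos t) hcard'
  -- finiteness of `Sel_v` at every `v ∣ p` (for (P9-𝓒) at `𝔭̄` and (L10))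
  have hfinv : ∀ v : HeightOneSpectrum (𝓞 K), ((p : ℕ) : 𝓞 K) ∈ v.asIdeal →
      Finite (selmerAcBase (W.baseChange K) p v ∅) := fun v hv ↦ by
    obtain ⟨hev, hfv⟩ := degreeOne_of_splitsIn hK.1 hsplit hv
    exact finite_selmerAcBase_of_rankOne_anyTorsion W p K
      (poitouTate_sum_localTatePairing_eq_zero_of_selmerStructure_duality (hPT K)) hK hsplit hrank hSha
      v hv hev hfv
  -- the conjugate prime `𝔮 = 𝔭̄`
  obtain ⟨σ, 𝔮, -, hne, h𝔮, -⟩ := LocalIndexTransport.exists_conj_prime_of_splitsIn K p hK.1 hsplit h𝔭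
  -- the torsion-robust count
  refine additiveControlOnTreeAt_of_torsAtoms (W := W) hK hsplit hpN hκ γ 𝔭 h𝔭 (embAt K p 𝔭 h𝔭 he hf)
    P g t (a - t) hg ht ⟨⟨hfin𝔭, hcardSel⟩, ?_⟩
    (ptSurj_of_finite W p hK hsplit (hPT K) h𝔭 h𝔮 hne (hfinv 𝔮 h𝔮) κ)
    (coinvariantsTrivialAt_of_finite_anyTorsion W p hK hsplit (hPT K) (hPT2 K) κ hγ.out h𝔭 hfinv)
    (r1LocalKernelOrderAt_of_anticyclotomicDecomposition (W := W) (p := p) hBr hp2 K hK κ hκ)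
  rw [Nat.cast_sub hle, ha]

/-- **CLASS-FREE CONTROL (the base unit's «AllF», memo ROUTE-P2-v6-g9 L87), unconditional but for
Kolyvagin's theorem**: for every globally minimal `E/ℚ` and prime `p` at which `E` is potentially
multiplicative or has semistability defect `2` (`Additive.PotMult E p ∨ Additive.semistabilityIndex E p = 2`;
on the socket's locus these are the cells (M) ∪ (G-ord, `e = 2`)), the pointwise anticyclotomic control input
`SchneiderFree.AdditiveControlInputManinAt E p` at every B6 Heegner datum and anticyclotomic frame — the
control EQUALITY `ord_p f_ac(0) = ord_p #Ш(E/K)[p^∞] + 2(ord_p log_ω P − ord_p[E(K):ℤP]) + ord_p ∏ c_w`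
(Euler shift `0`, `t_p` cancelling) — with NO hypothesis on the residual representation `E[p]` (X3 and X4
alike).  The four Poitou–Tate / Brink antecedents of `additiveControlInputManinAt_classFree_of_facts` are
discharged by the tree theorems `poitouTate_selmerStructure_duality_holds`, `poitouTate_sha_tateDual_holds`
(door-c4 g18/g19), `ZpExtension.decomp_not_le_kerSubgroup_of_isAnticyclotomic_holds` and
`…_above_of_isAnticyclotomic_holds` (Brink Thm. 2 / Cor. 1).  CONDITIONAL on Kolyvagin's theorem (cite-only
`kolyvagin`: rank `E(K) = 1` and `Ш(E/K)` finite for a non-torsion Heegner point), exactly as the X3 crux;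
closes no item; BSD is not proved by this. [cite: JetchevSkinnerWan2017, Thm. 3.3.1 (arXiv:1512.06894 p. 11)]
[cite: MilneADT2006, Ch. I, Thm. 4.10 (a),(b)] [cite: Brink2007, Thm. 2 and Cor. 1] [cite: Gross1991, Thm. 1.3] -/
theorem additiveControlInputManinAt_classFree
    (hKo : ∀ (N : ℕ) [NeZero N] (W : WeierstrassCurve ℚ) (K : Type) [Field K] [NumberField K],
      Literature.NumberTheory.EllipticCurves.kolyvagin N W K)
    (W : WeierstrassCurve ℚ) [W.IsElliptic] [W.IsGloballyMinimal] (p : ℕ) [Fact p.Prime]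
    (hcell : Additive.PotMult W p ∨ Additive.semistabilityIndex W p = 2) :
    SchneiderFree.AdditiveControlInputManinAt W p :=
  additiveControlInputManinAt_classFree_of_facts (fun K _ _ => poitouTate_selmerStructure_duality_holds K)
    (fun K _ _ => poitouTate_sha_tateDual_holds K) decomp_not_le_kerSubgroup_of_isAnticyclotomic_forall
    decomp_not_le_kerSubgroup_above_of_isAnticyclotomic_forall hKo W p hcell

/-- **The same under `Additive.SubSemistableTwist E p`** (= `SubM ∨ SubGordTwo`, the X3 items' cell
hypothesis with `ClassX3` dropped).  CONDITIONAL on Kolyvagin's theorem; BSD is not proved by this.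
[cite: JetchevSkinnerWan2017, Thm. 3.3.1 (arXiv:1512.06894 p. 11)] -/
theorem additiveControlInputManinAt_of_subSemistableTwist
    (hKo : ∀ (N : ℕ) [NeZero N] (W : WeierstrassCurve ℚ) (K : Type) [Field K] [NumberField K],
      Literature.NumberTheory.EllipticCurves.kolyvagin N W K)
    (W : WeierstrassCurve ℚ) [W.IsElliptic] [W.IsGloballyMinimal] (p : ℕ) [Fact p.Prime]
    (hS : Additive.SubSemistableTwist W p) :
    SchneiderFree.AdditiveControlInputManinAt W p :=
  additiveControlInputManinAt_classFree hKo W p (hS.imp_right fun h => h.2)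

/-- **The same on the N10 cells (M) ∪ (G-ord, `e = 2`)** — the hypothesis shape of the X4 leaf
`AdditiveX4RankOneLower` of memo ROUTE-P2-v6-g9 L85 (`N10.CellM E p ∨ N10.CellGordTwo E p`).  CONDITIONAL on Kolyvagin's
theorem; BSD is not proved by this. [cite: JetchevSkinnerWan2017, Thm. 3.3.1 (arXiv:1512.06894 p. 11)] -/
theorem additiveControlInputManinAt_of_cellM_or_cellGordTwo
    (hKo : ∀ (N : ℕ) [NeZero N] (W : WeierstrassCurve ℚ) (K : Type) [Field K] [NumberField K],
      Literature.NumberTheory.EllipticCurves.kolyvagin N W K)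
    (W : WeierstrassCurve ℚ) [W.IsElliptic] [W.IsGloballyMinimal] (p : ℕ) [Fact p.Prime]
    (hc : Additive.N10.CellM W p ∨ Additive.N10.CellGordTwo W p) :
    SchneiderFree.AdditiveControlInputManinAt W p :=
  additiveControlInputManinAt_classFree hKo W p (hc.imp (fun h => h.2.2) fun h => h.2.2.2)

/-- **Consistency: the X3 crux `AnticycControlAdditiveK` (stmt-BirchSwinnertonDyer-19295) by restriction of
the class-free theorem** (drop `r_an = 1` and `ClassX3`).  The item is already CLOSED by
`anticycControlAdditiveK_proof`; this records that the class-free statement is the stronger one.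
[cite: JetchevSkinnerWan2017, Thm. 3.3.1 (arXiv:1512.06894 p. 11)] -/
theorem anticycControlAdditiveK_of_classFree : AnticycControlAdditiveK :=
  fun hKo W _ _ p _ _ _ _ hS => additiveControlInputManinAt_of_subSemistableTwist hKo W p hS

/-- **Record 19178 `AnticycControlAdditive` ⟸ Kolyvagin, via the class-free theorem** (same content as
door-c4 g20's `anticycControlAdditive_of_kolyvagin`, re-derived here so the file is self-certifying).
[cite: Gross1991, Thm. 1.3] -/
theorem anticycControlAdditive_of_kolyvagin_classFree
    (hKo : ∀ (N : ℕ) [NeZero N] (W : WeierstrassCurve ℚ) (K : Type) [Field K] [NumberField K],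
      Literature.NumberTheory.EllipticCurves.kolyvagin N W K) :
    AnticycControlAdditive :=
  fun W _ _ p _ _ _ _ hS => additiveControlInputManinAt_of_subSemistableTwist hKo W p hS

end Summit.BirchSwinnertonDyer.BirchSwinnertonDyer.Theorems.SchneiderFreeAdditiveX3

end
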